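import Summits.AnomalousDissipation.AnomalousDissipation.Theses.StirringSphere
import Summits.AnomalousDissipation.AnomalousDissipation.Theses.Ensemble
import Summits.AnomalousDissipation.AnomalousDissipation.Theses.MomentParity
import Summits.AnomalousDissipation.AnomalousDissipation.Theorems.MomentParityGalerkinEnsembleRealization
import Literature.Analysis.FluidPDE.StatisticalSolutionEnergyEq

/-!
# Sketch for the crux ideas `galerkin-shadow` and `strassen-accretive`
(crux stmt-AnomalousDissipation-0215 `EnsembleRealization`; crux-ideate round 1, ideator k = 1)

Typed content (signatures only; `sorry` where not pure logic):

§A `galerkin-shadow`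
* `GalerkinLoudBounded` — verbatim the hypothesis block of the PROVED sibling crux
  `MomentParity.GalerkinEnsembleRealization` at budgets `(E', ε')`;
* `GalerkinShadow` (TRANSFER `C⁺`, lossless form) and `GalerkinShadowUpTo` (`η`-lossy form);
* `ensembleRealization_of_galerkinShadow` : `C⁺ → EnsembleRealization`, PROVED by name from the sibling;
* `fp_truncatedLiouville_defect` — FIRST LEMMA: Foias–Prodi Liouville identity tested on band-limited
  cylindrical functionals = Galerkin Liouville identity at `P_N u` up to the truncation-stress pairing.

§B `strassen-accretive`
* `ReachLH` (the Leray–Hopf reachability relation `Σ_h`), `PreimageAccretiveAt`;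
* `deficiency_eq_zero_of_subadditive` — subadditive + `o(h)` ⇒ `0` (PROVED, 15 lines of real analysis);
* `exists_stationaryCoupling_of_accretive` — FIRST LEMMA (Strassen's marriage theorem for `Σ_h`);
* `noStrongPast_le_shortLifetime` — necessity of strong pasts (FP-version of FRT CRAS 2010 Thm 5.1).
-/

noncomputable section

set_option linter.dupNamespace false

open MeasureTheory Set Filter Topology Function
open scoped BigOperators ENNReal InnerProductSpace RealInnerProductSpace

namespace Summit.AnomalousDissipation.AnomalousDissipation.Cruxes.EnsembleRealization.Ideate1

open Literature.Analysis.FunctionSpaces Literature.Analysis.FunctionSpaces.Torus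
open Literature.Analysis.FluidPDE Literature.Analysis.FluidPDE.Torus

local notation "𝕋³" => UnitAddTorus (Fin 3)
local notation "E³" => EuclideanSpace ℝ (Fin 3)
local notation "H³" => Torus.energySpace (Fin 3)

/-! ## §A  `galerkin-shadow` -/

/-- A level-`N` Galerkin-stationary law in the ball `R` with `κ`-uniform enstrophy tail and budgets
`(E', ε')`: VERBATIM the existential inside the hypothesis of `MomentParity.GalerkinEnsembleRealization`. -/
def GalerkinLoudBounded (ν : ℝ) (f : 𝕋³ → E³) (E' ε' R : ℝ) (κ : ℕ → ℕ) (N : ℕ) : Prop :=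
  ∃ μ : Measure H³, IsProbabilityMeasure μ ∧
    (∀ᵐ (u : H³) ∂μ, (∀ k ∉ (freqBall N).erase (0 : Fin 3 → ℤ),
      UnitAddTorus.mFourierCoeff (EuclideanSpace.complexify ∘ (u.1 : 𝕋³ → E³)) k = 0)) ∧
    (∀ᵐ u ∂μ, ‖u‖ ≤ R) ∧
    (∀ n : ℕ, ∫⁻ (u : H³), eGradNormSq (u.1 : 𝕋³ → E³) ∂μ ≤
      (∫⁻ (u : H³), eGradNormSq (fourierTruncate (κ n) (u.1 : 𝕋³ → E³)) ∂μ) + ((n : ENNReal) + 1)⁻¹) ∧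
    (∀ Φ : CylindricalTest (Fin 3), (∀ i, (∀ k ∉ (freqBall N).erase (0 : Fin 3 → ℤ),
      UnitAddTorus.mFourierCoeff (EuclideanSpace.complexify ∘ (Φ.g i)) k = 0)) →
      Integrable (fun u => nsGeneratorPairing ν f u (Φ.grad u)) μ ∧
        ∫ u, nsGeneratorPairing ν f u (Φ.grad u) ∂μ = 0) ∧
    ensembleEnergy μ ≤ E' ∧ ε' ≤ ensembleDissipation ν μ

/-- **TRANSFER `C⁺` (Galerkin shadow of Foias–Prodi budgets, lossless in `ε`).** For every loud bounded
Foias–Prodi measure at `(ν, f)` there are, for frequently many resolutions `N`, Galerkin-stationary laws with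
the SAME dissipation floor and an energy ceiling `E'(f, E, ε)` (uniform in `ν`, `μ`). A statement about
finite-dimensional smooth flows only. -/
def GalerkinShadow : Prop :=
  ∀ f : 𝕋³ → E³, IsSmooth f → IsDivFree f → HasZeroMean f → ∀ (E ε : ℝ), 0 < ε →
    ∃ E' : ℝ, ∀ (ν : ℝ) (μ : Measure H³), 0 < ν → IsStationaryStatisticalSolution ν f μ →
      ensembleEnergy μ ≤ E → ε ≤ ensembleDissipation ν μ →
      ∃ (R : ℝ) (κ : ℕ → ℕ), ∃ᶠ N in atTop, GalerkinLoudBounded ν f E' ε R κ N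

/-- The `η`-lossy shadow (the form the Krylov–Bogoliubov/response mechanism naturally gives): dissipation
`≥ ε - η` for every `η > 0`. It reaches the crux through the sibling's LANDED selection lemma
`Theorems.MomentParity.exists_mem_support_birkhoff_limits` with `D = ε - η`, `D' = ε/2` (any `η < ε/2`),
not through the sibling decl by name. -/
def GalerkinShadowUpTo : Prop :=
  ∀ f : 𝕋³ → E³, IsSmooth f → IsDivFree f → HasZeroMean f → ∀ (E ε : ℝ), 0 < ε →
    ∃ E' : ℝ, ∀ η : ℝ, 0 < η → ∀ (ν : ℝ) (μ : Measure H³), 0 < ν → IsStationaryStatisticalSolution ν f μ →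
      ensembleEnergy μ ≤ E → ε ≤ ensembleDissipation ν μ →
      ∃ (R : ℝ) (κ : ℕ → ℕ), ∃ᶠ N in atTop, GalerkinLoudBounded ν f E' (ε - η) R κ N

/-- **`C⁺ ⇒ crux`, by name from the LANDED proof of the sibling**
(`Theorems.MomentParity.galerkinEnsembleRealization_of`, stmt-AnomalousDissipation-11466;
`M := 16‖f‖₂²E'²/ε² + 1`). Pure logic; the only hypothesis is the transfer statement `GalerkinShadow`. -/
theorem ensembleRealization_of_galerkinShadow (hGS : GalerkinShadow) :
    Summit.AnomalousDissipation.AnomalousDissipation.Theses.StirringSphere.EnsembleRealization := by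
  intro f hs hdiv hz E ε hε
  obtain ⟨E', hE'⟩ := hGS f hs hdiv hz E ε hε
  obtain ⟨M, hM⟩ :=
    Summit.AnomalousDissipation.AnomalousDissipation.Theorems.MomentParity.galerkinEnsembleRealization_of
      f hs hdiv hz E' ε hε
  refine ⟨M, fun ν μ hν hμ _ hE hεμ => ?_⟩
  obtain ⟨R, κ, hfreq⟩ := hE' ν μ hν hμ hE hεμ
  exact hM ν hν R κ hfreq

/-- **FIRST LEMMA (the `t = 0` response/defect identity).** For a Foias–Prodi measure and a cylindrical
test functional with level-`N` band-limited test fields, the GALERKIN Liouville integrand at the truncation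
`P_N u` integrates to the truncation-stress pairing `∫ [b-terms of P_N u − b-terms of u](Φ'(u)) dμ`:
FP-stationarity of `μ` = Galerkin-stationarity of `(P_N)_* μ` up to the Reynolds/Leonard stress of the
unresolved modes. (The flowed version — `d/dt` of `∫ Φ(φᴺ_t(P_N u)) dμ` equals the `μ`-mean of the stress
paired with `∇(Φ ∘ φᴺ_t)` — is the same identity applied to the cylindrical test `Φ ∘ φᴺ_t ∘ P_N`.)
Provable now: FP generator identity + `integral_inner_fourierTruncate_eq` (band-limited invisibility of
`P_N` in the linear terms). -/
theorem fp_truncatedLiouville_defect {ν : ℝ} {f : 𝕋³ → E³} {μ : Measure H³}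
    (hμ : IsStationaryStatisticalSolution ν f μ) (hf : IsSmooth f) {N : ℕ} (Φ : CylindricalTest (Fin 3))
    (hband : ∀ i, ∀ k ∉ (freqBall N).erase (0 : Fin 3 → ℤ),
      UnitAddTorus.mFourierCoeff (EuclideanSpace.complexify ∘ (Φ.g i)) k = 0) :
    ∫ u, ((∫ x, ⟪f x, Φ.grad u x⟫_ℝ) +
        ν * (∫ x, ⟪fourierTruncate N (u.1 : 𝕋³ → E³) x, Torus.laplacian (Φ.grad u) x⟫_ℝ) +
        inertialPairing ((memLp_fourierTruncate N (u.1 : 𝕋³ → E³) 2).toLp _) (Φ.grad u)) ∂μ =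
      ∫ u, (inertialPairing ((memLp_fourierTruncate N (u.1 : 𝕋³ → E³) 2).toLp _) (Φ.grad u) -
        inertialPairing (u.1 : Lp E³ 2 (volume : Measure 𝕋³)) (Φ.grad u)) ∂μ := by
  sorry

/-! ## §B  `strassen-accretive` -/

/-- The **Leray–Hopf reachability relation** `z ∈ Σ_h(u)`: some global Leray–Hopf solution of NS_ν(f)
issued from (a representative of) `u` passes through (a representative of) `z` at time `h`
(FMRT App. C: `Σ_t ω`). -/
def ReachLH (ν : ℝ) (f : 𝕋³ → E³) (h : ℝ) (u z : H³) : Prop :=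
  ∃ v : ℝ → 𝕋³ → E³, IsGlobalLerayHopf ν (fun _ => f) ((u.1 : Lp E³ 2 (volume : Measure 𝕋³)) : 𝕋³ → E³) v ∧
    v h =ᵐ[volume] ((z.1 : Lp E³ 2 (volume : Measure 𝕋³)) : 𝕋³ → E³)

/-- **Preimage accretivity at time `h`** (Strassen's marriage condition for a self-coupling of `μ` along
`Σ_h`; FMRT Def. C.1 is the image form `μ(Σ_h ω) ≥ μ(ω)`): no Borel set holds more mass than the set of
states from which it is LH-reachable in time `h`. -/
def PreimageAccretiveAt (ν : ℝ) (f : 𝕋³ → E³) (h : ℝ) (μ : Measure H³) : Prop :=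
  ∀ B : Set H³, MeasurableSet B → μ B ≤ μ {u | ∃ z ∈ B, ReachLH ν f h u z}

/-- **A stationary one-step coupling along `Σ_h`** (what Strassen's theorem delivers). -/
def HasStationaryCoupling (ν : ℝ) (f : 𝕋³ → E³) (h : ℝ) (μ : Measure H³) : Prop :=
  ∃ π : Measure (H³ × H³), π.map Prod.fst = μ ∧ π.map Prod.snd = μ ∧ ∀ᵐ p ∂π, ReachLH ν f h p.1 p.2

/-- **Subadditive deficiencies that are `o(h)` vanish identically.** The coupling deficiency
`d(h) = 1 − sup_π π(graph Σ_h)` is subadditive under concatenation of Leray–Hopf segments; this elementary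
lemma is why an INFINITESIMAL (`o(h)`) accretivity statement is as good as exact accretivity. PROVED. -/
theorem deficiency_eq_zero_of_subadditive (d : ℝ → ℝ) (hd0 : ∀ h, 0 < h → 0 ≤ d h)
    (hsub : ∀ h h', 0 < h → 0 < h' → d (h + h') ≤ d h + d h')
    (hsmall : Tendsto (fun h => d h / h) (𝓝[>] 0) (𝓝 0)) : ∀ h, 0 < h → d h = 0 := by
  intro h hh
  -- `d h ≤ n • d (h / n)` for every `n ≥ 1`
  have hstep : ∀ n : ℕ, 0 < n → d h ≤ n * d (h / n) := by
    intro n hn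
    have key : ∀ m : ℕ, 0 < m → ∀ s : ℝ, 0 < s → d (m * s) ≤ m * d s := by
      intro m hm s hs
      induction m with
      | zero => exact absurd hm (lt_irrefl 0)
      | succ m ih =>
        rcases Nat.eq_zero_or_pos m with h0 | hpos
        · subst h0; simp
        · have h1 : d ((m : ℝ) * s + s) ≤ d ((m : ℝ) * s) + d s :=
            hsub _ _ (by positivity) hs
          have h2 := ih hpos
          push_cast
          calc d (((m : ℝ) + 1) * s) = d ((m : ℝ) * s + s) := by ring_nf
            _ ≤ d ((m : ℝ) * s) + d s := h1
            _ ≤ (m : ℝ) * d s + d s := by linarith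
            _ = ((m : ℝ) + 1) * d s := by ring
    have hs : 0 < h / n := div_pos hh (by exact_mod_cast hn)
    have := key n hn (h / n) hs
    have hn' : (n : ℝ) ≠ 0 := by exact_mod_cast hn.ne'
    rwa [mul_div_cancel₀ _ hn'] at this
  -- let `n → ∞`: `n * d (h/n) = h * (d (h/n) / (h/n)) → 0`
  have hlim : Tendsto (fun n : ℕ => (n : ℝ) * d (h / n)) atTop (𝓝 0) := by
    have hseq : Tendsto (fun n : ℕ => h / (n : ℝ)) atTop (𝓝[>] 0) := by
      refine tendsto_nhdsWithin_iff.2 ⟨?_, ?_⟩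
      · exact tendsto_const_div_atTop_nhds_zero_nat h
      · filter_upwards [eventually_gt_atTop 0] with n hn
        exact div_pos hh (by exact_mod_cast hn)
    have h1 : Tendsto (fun n : ℕ => d (h / n) / (h / n)) atTop (𝓝 0) := hsmall.comp hseq
    have h2 : Tendsto (fun n : ℕ => h * (d (h / n) / (h / n))) atTop (𝓝 (h * 0)) := h1.const_mul h
    rw [mul_zero] at h2
    refine h2.congr' ?_
    filter_upwards [eventually_gt_atTop 0] with n hn
    have hn' : (n : ℝ) ≠ 0 := by exact_mod_cast hn.ne'
    field_simp
  have hle : d h ≤ 0 :=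
    ge_of_tendsto hlim (eventually_atTop.2 ⟨1, fun n hn => hstep n hn⟩)
  exact le_antisymm hle (hd0 h hh)

/-- **FIRST LEMMA of the line (Strassen's marriage theorem for `Σ_h`).** A Foias–Prodi measure (carried by
the FMRT ball, a Polish space in the norm topology whose closed bounded sets are weakly compact) that is
preimage-accretive at time `h` admits a stationary one-step coupling along `Σ_h`. Ingredients: Strassen 1965
Thm 11 / Kellerer 1984 duality on `(B̄_R, ‖·‖) × (B̄_R, weak)`; closedness of `graph Σ_h` there (Leray–Hopf
stability under STRONG convergence of data, weak convergence at time `h`). [cite: Strassen1965, Thm 11] -/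
theorem exists_stationaryCoupling_of_accretive {ν : ℝ} (hν : 0 < ν) {f : 𝕋³ → E³} (hf : IsSmooth f)
    (hdiv : IsDivFree f) (hf0 : HasZeroMean f) {μ : Measure H³} (hμ : IsStationaryStatisticalSolution ν f μ)
    {h : ℝ} (hh : 0 < h) (hacc : PreimageAccretiveAt ν f h μ) : HasStationaryCoupling ν f h μ := by
  sorry

/-- **NECESSITY OF STRONG PASTS (FP-version of Foias–Rosa–Temam, CRAS 348 (2010), Thm 5.1; and the
cheapest falsifier of every exact-marginal lift).** If `μ` is stationarily coupled along `Σ_h`, the mass of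
states WITHOUT a strong (enstrophy-bounded) Leray–Hopf past of length `h` is at most the mass of states whose
forward strong lifetime is `≤ h` — by weak–strong uniqueness every LH solution from a state with lifetime
`> h` is strong on `[0, h]`. With (1.29) and the lifespan bound `T* ≳ ν³/‖∇u₀‖₂⁴` the right side is
`≲ h^{1/2} ⟨‖∇u‖²⟩ ν^{-3/2}`. Stated with an abstract lifetime functional `θ` dominated by LH regularity. -/
theorem noStrongPast_le_shortLifetime {ν : ℝ} (hν : 0 < ν) {f : 𝕋³ → E³} (hf : IsSmooth f)
    {μ : Measure H³} (hμ : IsStationaryStatisticalSolution ν f μ) {h : ℝ} (hh : 0 < h)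
    (hcpl : HasStationaryCoupling ν f h μ)
    (θ : H³ → ℝ) (hθm : Measurable θ)
    (hθ : ∀ (u : H³) (v : ℝ → 𝕋³ → E³),
      IsGlobalLerayHopf ν (fun _ => f) ((u.1 : Lp E³ 2 (volume : Measure 𝕋³)) : 𝕋³ → E³) v → h < θ u →
        ∃ C : ℝ, ∀ t ∈ Icc 0 h, (eGradNormSq (v t)).toReal ≤ C) :
    μ {z | ¬ ∃ (u : H³) (v : ℝ → 𝕋³ → E³),
        IsGlobalLerayHopf ν (fun _ => f) ((u.1 : Lp E³ 2 (volume : Measure 𝕋³)) : 𝕋³ → E³) v ∧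
          v h =ᵐ[volume] ((z.1 : Lp E³ 2 (volume : Measure 𝕋³)) : 𝕋³ → E³) ∧
          ∃ C : ℝ, ∀ t ∈ Icc 0 h, (eGradNormSq (v t)).toReal ≤ C} ≤ μ {u | θ u ≤ h} := by
  sorry

end Summit.AnomalousDissipation.AnomalousDissipation.Cruxes.EnsembleRealization.Ideate1
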